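import Literature.MathematicalPhysics.QuantumFieldTheory.MullerSchiemann1987.MS87ClassFunctionsSU2
import Literature.MathematicalPhysics.QuantumFieldTheory.Balaban1983to89.UnitaryModel
import Mathlib.Analysis.Calculus.Deriv.Comp
import HarnessLib

/-!
# Crux `FluctuationComparisonRegPrIntL` (stmt-QuantumFields-20520, rung R3), PATH-B organ O1 → v18 «O1ᵘ-H», typing note TN-GR (gradient channel) —
# KERNEL FORM OF THE RESOLUTION (GR-b′) «VOID BY GLOBAL GAUGE SYMMETRY» (ideator ym-r3-idea-1 g26 №18, `Cruxes/…/GREven.lean`; LEAD WORD №18 concur):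
# a gauge-invariant function of a ONE-BOND EXCITATION OF THE FLAT CONFIGURATION is a CLASS FUNCTION of the bond variable, hence INVERSION-EVEN,
# hence every one-parameter derivative at the flat anchor VANISHES (when it exists)

LEAD-20520 width seat ym-ust-20520-w3 g23 (cell ym3-torus), `--supports stmt-QuantumFields-20520` (helper).  THEOREMS ONLY, def-free; generic lattice
`P : Params`, level `j`, gauge group `SU(2)`; no O1∕v18 text is restated (EMBARGO-LITE respected) — this is the symmetry lemma the Hessian-currency package
will import for its anchored-gradient letters (`g⁰_b ≡ 0`).

§1 `gaugeAct_const_update_one` — a CONSTANT gauge transformation `x ↦ h` fixes the flat field and conjugates a one-bond excitation: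
   `(update 1 b g)^h = update 1 b (h g h⁻¹)`.
§2 ★`flatBond_apply_conj_eq` — for gauge-invariant `R`, `g ↦ R (update 1 b g)` is a class function on `SU(2)`; ★`flatBond_apply_inv_eq` — hence
   `R (update 1 b g⁻¹) = R (update 1 b g)` (in `SU(2)` every element is conjugate to its inverse: ✓`ClassFunctionsSU2.central_apply_eq_of_u0_eq` +
   ✓`HeatKernel.u0_inv`).
§3 `deriv_eq_zero_of_even` ([folklore]: an even real function differentiable at `0` has derivative `0` there) and ★★`deriv_flatBond_eq_zero`: for every
   curve `e : ℝ → SU(2)` with `e (−t) = (e t)⁻¹` (e.g. a one-parameter subgroup), `t ↦ R (update 1 b (e t))` is even, so its derivative at `0` is `0`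
   whenever it is differentiable there — the anchored flat-background gradient letter of TN-GR is VOID for gauge-invariant remainders.

HONEST FRAMING: a symmetry remark (group theory + one line of calculus); nothing of Bałaban's analysis is asserted; differentiability at the anchor is a
HYPOTHESIS here (v18's analytic window (β) supplies it); O1ᵘ-H, LIN∘, crux 20520, `YM3TorusSU2` are NOT proved; registry `Lines/semiclassical_s2beta.lean`
v11.4 (★★OWNER RULING №36) untouched; rung R3 = SU(2) YM₃ on T³ — NOT d = 4, NOT infinite volume, NOT a mass gap, NOT Clay; the Yang–Mills mass gap is NOT
proved by any of this.
-/

set_option autoImplicit false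

noncomputable section

namespace Summit.QuantumFields.YangMills.Theorems.OrganTangentFlatAnchorEven

open Function Filter Topology
open Literature.MathematicalPhysics.QuantumFieldTheory.Balaban1983to89
open Literature.MathematicalPhysics.QuantumFieldTheory.MullerSchiemann1987
open Literature.MathematicalPhysics.QuantumFieldTheory.MullerSchiemann1987.HeatKernel (u0 u0_inv)
open Literature.MathematicalPhysics.QuantumFieldTheory.MullerSchiemann1987.ClassFunctionsSU2 (central_apply_eq_of_u0_eq)

variable {P : Params} {j : ℕ} [DecidableEq (PBond P j)]

/-! ## §1 Constant gauge transformations of a one-bond excitation of the flat field -/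

/-- A constant gauge transformation conjugates a one-bond excitation of the flat configuration. [cite: Balaban1985Averaging, (8) p.19] -/
theorem gaugeAct_const_update_one (h : Matrix.specialUnitaryGroup (Fin 2) ℂ) (b : PBond P j) (g : Matrix.specialUnitaryGroup (Fin 2) ℂ) :
    GaugeField.gaugeAct (fun _ : Site P j => h) (update (1 : GaugeField P j (Matrix.specialUnitaryGroup (Fin 2) ℂ)) b g) =
      update (1 : GaugeField P j (Matrix.specialUnitaryGroup (Fin 2) ℂ)) b (h * g * h⁻¹) := by
  funext e
  by_cases he : e = b
  · subst he
    simp only [GaugeField.gaugeAct, update_self]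
  · simp only [GaugeField.gaugeAct, update_of_ne he]
    show h * 1 * h⁻¹ = 1
    rw [mul_one, mul_inv_cancel]

/-! ## §2 Gauge-invariant functions of a one-bond excitation are class functions, hence inversion-even -/

/-- ★ For gauge-invariant `R`, `g ↦ R (update 1 b g)` is a class function on `SU(2)`. [cite: Balaban1985Averaging, (12)-(13) p.19] -/
theorem flatBond_apply_conj_eq {α : Type*} {R : GaugeField P j (Matrix.specialUnitaryGroup (Fin 2) ℂ) → α}
    (hR : GaugeField.GaugeInvariant R) (b : PBond P j) (g h : Matrix.specialUnitaryGroup (Fin 2) ℂ) :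
    R (update 1 b (h * g * h⁻¹)) = R (update 1 b g) :=
  (congrArg R (gaugeAct_const_update_one h b g)).symm.trans (hR _ _)

/-- ★ **Inversion-evenness at the flat anchor**: `R (update 1 b g⁻¹) = R (update 1 b g)` for gauge-invariant `R` — every element of `SU(2)` is
conjugate to its inverse. [cite: MullerSchiemann1987, (2.2)-(2.3) p.263; Balaban1985Averaging, (12) p.19] -/
theorem flatBond_apply_inv_eq {α : Type*} {R : GaugeField P j (Matrix.specialUnitaryGroup (Fin 2) ℂ) → α}
    (hR : GaugeField.GaugeInvariant R) (b : PBond P j) (g : Matrix.specialUnitaryGroup (Fin 2) ℂ) :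
    R (update 1 b g⁻¹) = R (update 1 b g) :=
  central_apply_eq_of_u0_eq (g := fun g => R (update 1 b g)) (fun u v => flatBond_apply_conj_eq hR b u v) (u0_inv g)

/-! ## §3 Even ⟹ zero derivative at the anchor -/

/-- An even real function differentiable at `0` has derivative `0` there. [folklore] -/
theorem deriv_eq_zero_of_even {φ : ℝ → ℝ} (heven : ∀ t, φ (-t) = φ t) (hd : DifferentiableAt ℝ φ 0) : deriv φ 0 = 0 := by
  have h1 : HasDerivAt φ (deriv φ 0) 0 := hd.hasDerivAt
  have h2 : HasDerivAt (fun t => φ (-t)) (deriv φ 0 * (-1)) 0 := by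
    have hn : HasDerivAt (fun t : ℝ => -t) (-1) 0 := hasDerivAt_neg 0
    have h1' : HasDerivAt φ (deriv φ 0) (-(0 : ℝ)) := by simpa using h1
    exact h1'.comp 0 hn
  have h3 : (fun t => φ (-t)) = φ := funext heven
  rw [h3] at h2
  have := h1.unique h2
  linarith

/-- ★★ **THE ANCHORED GRADIENT VANISHES**: for gauge-invariant `R`, a bond `b` and a curve `e : ℝ → SU(2)` with `e (−t) = (e t)⁻¹` (a one-parameter
subgroup, say), `t ↦ R (update 1 b (e t))` is even, so its derivative at `0` is `0` whenever it is differentiable there.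
[cite: Balaban1985Averaging, (12)-(13) p.19; MullerSchiemann1987, (2.3) p.263] -/
theorem deriv_flatBond_eq_zero {R : GaugeField P j (Matrix.specialUnitaryGroup (Fin 2) ℂ) → ℝ}
    (hR : GaugeField.GaugeInvariant R) (b : PBond P j) {e : ℝ → Matrix.specialUnitaryGroup (Fin 2) ℂ}
    (he : ∀ t, e (-t) = (e t)⁻¹) (hd : DifferentiableAt ℝ (fun t => R (update 1 b (e t))) 0) :
    deriv (fun t => R (update 1 b (e t))) 0 = 0 :=
  deriv_eq_zero_of_even (fun t => by
    show R (update 1 b (e (-t))) = R (update 1 b (e t))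
    rw [he t, flatBond_apply_inv_eq hR b]) hd

end Summit.QuantumFields.YangMills.Theorems.OrganTangentFlatAnchorEven

end
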